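import Mathlib
import Literature.MathematicalPhysics.QuantumLattice.FermiRG.Salmhofer1998SkeletonInputs
import HarnessLib

/-!
# Salmhofer 1998 Theorems 4 and 5 as corollaries of Theorems 6 and 7: the flow freezes beyond
# `log(βε₀/π)` at Matsubara frequencies, and the recursion (6.25) has a solution

Theorem-only companion of F7e `Salmhofer1998Sec6.lean` and F7ac `Salmhofer1998SkeletonInputs.lean`
(gate-hubbard-kl wave, t7 g11).  M. Salmhofer, *Continuous renormalization for fermions and Fermi liquid
theory*, Commun. Math. Phys. **194** (1998) 249–295 = arXiv:cond-mat/9706188 [Salmhofer1998]; locators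
`p.N Ln` = chunk `pNNNN.txt` line `n` of the materialised arXiv TeX (`lit read arxiv:cond-mat/9706188`), NOT
printed pages; stable locators are the paper's numbers.

F7e types Theorems 4–7 of §6 as four named facts: `SkeletonSelfEnergyRegularity` (Theorem 4, F-094),
`SkeletonWithLadderBounds` (Theorem 5, F-095), `SkeletonRegularity` (Theorem 6, F-096), `SkeletonLogBounds`
(Theorem 7, F-097).  In print, Theorems 4 and 5 are COROLLARIES of Theorems 6 and 7, with two-line proofs:

* proof of Theorem 4 (p.25 L64–75): "Let `|α| ≤ 1`. By (6.29), `|D^α I^N_{2r}(t)| ≤ K_{2,r}` … The second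
  derivative of `Q^N_{2,r}` is `O(t)` in `d = 2` and `O(1)` in `d = 3`. Since `Q^N_{2,r} = 0` for `t > log βε₀`,
  the integral for `I^N_{2,r}` over `t` runs only up to `log βε₀`, which gives the stated dependence on
  `log βε₀`";
* proof of Theorem 5 (p.25 L150–156): "Convergence of the selfenergy follows for `|α| ≤ 1` as in the proof of
  Theorem 4. For `m = 4`, the function is bounded uniformly in `t`. For `|α| = 2`, convergence at `β > 0` holds
  because `∂/∂t I^S_{4r}(t) = 0` for `t > log βε₀`" and (p.24 L44–56 with (6.34), (6.36)) "(6.22) is a direct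
  consequence of (6.34) and (6.36)".

THIS file proves exactly these two implications between the named facts, sorry-free:
`skeletonSelfEnergyRegularity_of_skeletonRegularity : SkeletonRegularity → SkeletonSelfEnergyRegularity` and
`skeletonWithLadderBounds_of_skeletonLogBounds : SkeletonLogBounds → SkeletonWithLadderBounds`, so that licences
F-094 and F-095 are discharged by F-096 and F-097 (no new fact is introduced).  The ingredients, each the
printed one:

* **"`Q_{m,r} = 0` for `t > log βε₀`" = Lemma 4 on the right-hand side of the RGE** (p.19 L133–135: "If
  `t > log(βε₀/π)`, then `Ĉ_t(p) = 0`"; F7ac `vanishesBeyond_modelProp`) — `momQuadTerm_eq_zero_of_freq`: for ANY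
  scale family whose `Ĉ_s`, `Ċ_s` vanish at all frequencies `|p₀| ≥ π/β`, every term of F7e's `momQuadTerm`
  (Proposition 2's `∫dκ_{mr}` sum, (5.?) `\Qfour`, p.17 L135–152) vanishes at Matsubara external legs: for `i ≥ 2` a loop line
  `Ĉ_s(ω_β((k_j)₀), 𝐤_j)` is a factor (`|ω_β| ≥ π/β`), and for `i = 1` the connecting line `Ċ_s` sits at `∓` the
  sum of the `m₁ - 1` external legs routed through the first vertex — an ODD number of fermionic Matsubara
  frequencies since `m₁` is even (`MIndex`), so `|p₀| ≥ π/β` (`pi_div_le_abs_sum_matsFreq`); for the many-fermion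
  propagator (5.17) the vanishing holds once `s > log(βε₀/π)` (`modelProp_eq_zero_of_freq`,
  `modelPropDot_eq_zero_of_freq`, from F7c/F7ac), whence `momQuadTerm_modelProp_eq_zero`;
* **"the integral for `I` over `t` runs only up to `log βε₀`"** — `momRGESolution_frozen`: a solution of the
  integral equation `I(t) = I(0) + ½𝔸_m ∫_0^t Q(s) ds` (`IsMomRGESolution`, any selector) whose `Q(s | ·)` vanishes
  at Matsubara legs for `s > T ≥ 0` satisfies `I_{m,r}(t | P) = I_{m,r}(T | P)` for `t ≥ T` at Matsubara `P`
  (`𝔸_m` permutes Matsubara legs; the two time integrands agree on `[0,t]`, so no integrability is needed);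
  `momRGESolution_modelProp_frozen` is the instance for (5.17) with any `T > log(βε₀/π)`;
* **the constants `K_{mr}` of (6.25)** — `skelK K0 M₀ J₁` with `isSkeletonK_skelK : IsSkeletonK K0 M₀ J₁ (skelK …)`:
  the recursion (p.24 L107–115) determines `K_{mr}` from `K_{m'r'}`, `r' < r` (fuelled recursion `skelKFuel` +
  stabilisation `skelKFuel_stable`; `kappaSum_congr`: `∫dκ_{mr}` evaluates its argument only at `r₁ + r₂ = r`,
  `r₁, r₂ ≥ 1`), so Theorems 6/7 — typed "for every `K` satisfying (6.25)" — apply to it;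
* **locality of `D^α` on the Matsubara set** — `multiLegPartial_congr_mats`: F7e's spatial derivatives
  `multiLegPartial α F P` (Fréchet derivatives of the spatial section `𝐪 ↦ F(withSpatial P 𝐪)`) at a Matsubara `P`
  depend only on `F` restricted to Matsubara configurations, so the frozen values carry over to all `D^α I(t)`.

With these, **Theorem 4 ⇐ Theorem 6** (`skeletonSelfEnergyRegularity_of_skeletonRegularity`): take `M₀` from
Theorem 6, `K := skelK K^{(0)} M₀ J₁`, `K^{(2)}_r := K_{2r}`, `K^{(4)}_r := K_{4r}(1 + ε₀⁻¹)` (chosen before `β`),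
and, given `βε₀ ≥ 6`, the freezing time `T := log(βε₀) - 1`: `T ≥ 0` and `T > log(βε₀/π)` because `log π > 1`
(`freeze_window`; print substitutes "`t = log βε₀`", any `T ∈ (log(βε₀/π), log βε₀]` does, and this choice makes
`1 + T = log βε₀` exactly).  At Matsubara `P` and `t ≥ 0`, `D^α I_{mr}(t | P) = D^α I_{mr}(t' | P)` with
`t' = min(t, T)`, and (6.28)/(6.29) at `t'` give (6.20)/(6.21): `(1+t')^k ≤ (log βε₀)^k`, and for the `|α| = 2`
four-point clause `ε_{t'}⁻¹ (1+t') ≤ β log βε₀ ≤ (1+ε₀⁻¹)(βε₀)(1 + log βε₀)` (`inv_epsT_le_beta`: `ε_t⁻¹ = e^t/ε₀ ≤ β`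
for `t ≤ log βε₀`) — the typed powers `(1 + log βε₀)²`, `βε₀(1 + log βε₀)` of F7e's audit item 6.  The limit is
`S := I_{2,r}(T | ·)` (the flow is constant from `T` on), `C²` in the spatial momenta by Theorem 6's regularity
clause.  **Theorem 5 ⇐ Theorem 7** (`skeletonWithLadderBounds_of_skeletonLogBounds`): `K^{(5)}_{mr} := K_{mr}`;
(6.36) gives the `m = 2` clause of (6.22) as `L^{r-2} ≤ L^r` and `L^{r-2}L^{1+δ_{d,2}} ≤ L^r` for `L = log βε₀ ≥ 1`,
`r ≥ 2` (`r = 1`: `K_{21} = K^{(0)}_{21} = 0`, `skeletonK_two_one`); (6.34) at `m = 4`, `α = 0` gives the four-point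
clause (`L^{r-1} ≤ L^r`); convergence at Matsubara legs is eventual constancy (`tendsto_of_frozen`).
Nonnegativity of the `K_{mr}` used in these monotonicity steps is read off the bounds themselves
(`nonneg_of_norm_le_mul`).

Revision 2 (t7 g11, theorem-only append): **Theorem 6's first conclusion "`K_{mr} = 0` for `m > 2r+2`"**
(p.24 L115–116) is proved outright for every `K` satisfying (6.25) with Theorem 6's initial constants
(`skeletonK_eq_zero_of_deg`): the skeleton `∫dκ^S_{mr}` with `m̄(r) = 2r+2` is the empty sum when `m > 2r+2`
(`kappaSum_mfDeg_eq_zero`; Lemma 3, p.18 L138–145), and `K_{m1} = δ_{m4} v`.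

Faithfulness.  Nothing is asserted: the two headline theorems are implications between F7e's facts as typed
(revision 2), and every auxiliary statement is proved.  The freezing lemma is stated for F7e's `momQuadTerm`
with an arbitrary selector, so it serves Definition 2 (skeleton), Definition 3 (non-ladder) and the full flow
alike; it uses finite `β > 0` (Matsubara frequencies `(2n+1)π/β`), as print does ("convergence at `β > 0`",
p.25 L154).  Mathlib: `intervalIntegral.integral_of_le`, `MeasureTheory.setIntegral_congr_fun`,
`MeasureTheory.setIntegral_indicator`, `Filter.Tendsto.congr'`, `fderiv` through F7e's `legPartial`.
-/

noncomputable section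

open MeasureTheory Filter Set
open scoped Topology ENNReal

namespace Literature.MathematicalPhysics.QuantumLattice.FermiRG

namespace Salmhofer1998

variable {d : ℕ}

/-! ### Matsubara frequencies beyond the scale: the propagators vanish -/

/-- `ε_t < π/β` iff `t > log(βε₀/π)` (the direction used). [cite: Salmhofer1998, Lemma 4 (p.19 L133–135)] -/
theorem epsT_lt_pi_div_of_log_lt {eps0 β t : ℝ} (h0 : 0 < eps0) (hβ : 0 < β)
    (ht : Real.log (β * eps0 / Real.pi) < t) : epsT eps0 t < Real.pi / β := by
  have hπ := Real.pi_pos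
  unfold epsT
  have hpos : 0 < β * eps0 / Real.pi := by positivity
  rw [Real.log_lt_iff_lt_exp hpos] at ht
  rw [Real.exp_neg, lt_div_iff₀ hβ]
  have hexp := Real.exp_pos t
  rw [div_lt_iff₀ hπ] at ht
  calc eps0 * (Real.exp t)⁻¹ * β = β * eps0 / Real.exp t := by field_simp
    _ < Real.pi := by rw [div_lt_iff₀ hexp]; linarith

/-- `|x| ≤ |ix - y|` for real `x, y`. [cite: Salmhofer1998, Lemma 4 proof (p.20 L2–3)] -/
theorem abs_le_norm_I_mul_sub (x y : ℝ) : |x| ≤ ‖Complex.I * (x : ℂ) - (y : ℂ)‖ := by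
  have := Complex.abs_im_le_norm (Complex.I * (x : ℂ) - (y : ℂ))
  simpa using this

/-- The many-fermion propagator vanishes at every frequency `|x| ≥ π/β` once `t > log(βε₀/π)` (Lemma 4:
"for `C_t(p)` to be nonzero, `|ω_β(p₀)| ≤ ε_t` must hold", p.20 L2–3, and `ε_t < π/β`).
[cite: Salmhofer1998, Lemma 4 (p.19 L133–135), proof p.20 L2–3] -/
theorem modelProp_eq_zero_of_freq {M : ModelData d} (hM : M.Hyp) {χ₁ : ℝ → ℝ} (hχ : IsCutoff χ₁) {β : ℝ}
    (hβ : 0 < β) {t : ℝ} (ht : Real.log (β * M.eps0 / Real.pi) < t) {x : ℝ} (hx : Real.pi / β ≤ |x|)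
    (p : Mom d) : modelProp M χ₁ t (x, p) = 0 := by
  unfold modelProp
  apply covC_eq_zero_of_lt hχ hM.eps0_pos
  exact lt_of_lt_of_le (lt_of_lt_of_le (epsT_lt_pi_div_of_log_lt hM.eps0_pos hβ ht) hx)
    (abs_le_norm_I_mul_sub x (M.E p))

/-- Likewise `Ċ_t` vanishes at every frequency `|x| ≥ π/β` once `t > log(βε₀/π)` ((5.18) at `α = 0`: `Ċ_t` is
supported in `|ix - y| ≤ ε_t`). [cite: Salmhofer1998, Lemma 4 (5.18) (p.19 L138–145)] -/
theorem modelPropDot_eq_zero_of_freq {M : ModelData d} (hM : M.Hyp) {χ₁ : ℝ → ℝ} (hχ : IsCutoff χ₁) {β : ℝ}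
    (hβ : 0 < β) {t : ℝ} (ht : Real.log (β * M.eps0 / Real.pi) < t) {x : ℝ} (hx : Real.pi / β ≤ |x|)
    (p : Mom d) : modelPropDot M χ₁ t (x, p) = 0 := by
  unfold modelPropDot
  have h := norm_covCDot_le hχ hM.eps0_pos t x (M.E p)
  have hlt : epsT M.eps0 t < ‖Complex.I * (x : ℂ) - (M.E p : ℂ)‖ :=
    lt_of_lt_of_le (lt_of_lt_of_le (epsT_lt_pi_div_of_log_lt hM.eps0_pos hβ ht) hx)
      (abs_le_norm_I_mul_sub x (M.E p))
  rw [if_neg (not_le.mpr hlt), mul_zero] at h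
  exact norm_le_zero_iff.mp h

/-- A propagator insertion `C̄_t(K) = ±Ĉ_t(±k)` (5.3) vanishes when `Ĉ_t` vanishes at the frequencies `±k₀`.
[cite: Salmhofer1998, §5.1 (5.3) (p.17 L61–76)] -/
theorem legProp_eq_zero_of_freq {C : ℝ → FMom d → ℂ} {t β : ℝ}
    (hC : ∀ (x : ℝ) (p : Mom d), Real.pi / β ≤ |x| → C t (x, p) = 0) {K : Leg d}
    (hK : Real.pi / β ≤ |K.1.1|) : legProp C t K = 0 := by
  unfold legProp
  obtain ⟨⟨x, p⟩, σ, j⟩ := K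
  simp only at hK ⊢
  split_ifs with hj
  · rw [Prod.neg_mk, hC (-x) (-p) (by rwa [abs_neg]), neg_zero]
  · exact hC x p hK

/-- **A sum of an odd number of fermionic Matsubara frequencies is at least `π/β` in absolute value**
(`Σ_j (π/β)(2n_j+1) = (π/β)(2N + k)` with `k` odd).  This is why, at Matsubara external momenta, the line
`Ċ_t(k₁)` of the RGE with `k₁ = p₁ + … + p_{m₁-1}` (no integrated line, `m₁` even) vanishes beyond `log(βε₀/π)`.
[cite: Salmhofer1998, §5.3 (p.18 L121–125) and Lemma 4 (p.19 L133–135)] -/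
theorem pi_div_le_abs_sum_matsFreq {β : ℝ} (hβ : 0 < β) {k : ℕ} (hk : Odd k) (n : Fin k → ℤ) :
    Real.pi / β ≤ |∑ j, matsFreq β (n j)| := by
  have hπ := Real.pi_pos
  have hsum : ∑ j, matsFreq β (n j) = Real.pi / β * (((2 * ∑ j, n j + k : ℤ)) : ℝ) := by
    simp only [matsFreq, ← Finset.mul_sum]
    congr 1
    push_cast
    rw [Finset.sum_add_distrib, Finset.sum_const, Finset.card_univ, Fintype.card_fin, Finset.mul_sum]
    simp
  rw [hsum, abs_mul, abs_of_pos (div_pos hπ hβ)]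
  have hodd : (2 * ∑ j, n j + k : ℤ) ≠ 0 := by
    obtain ⟨k', hk'⟩ := hk
    omega
  have h1 : (1 : ℝ) ≤ |((2 * ∑ j, n j + k : ℤ) : ℝ)| := by
    rw [← Int.cast_abs]
    exact_mod_cast Int.one_le_abs hodd
  calc Real.pi / β = Real.pi / β * 1 := by ring
    _ ≤ Real.pi / β * |((2 * ∑ j, n j + k : ℤ) : ℝ)| := by gcongr

/-- The frequency of a sum of an odd number of Matsubara legs is at least `π/β` in absolute value.
[cite: Salmhofer1998, §5.3 (p.18 L121–125)] -/
theorem pi_div_le_abs_fst_sum_of_isMats {β : ℝ} (hβ : 0 < β) {k : ℕ} (hk : Odd k) (f : Fin k → Leg d)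
    (hf : ∀ j, ∃ n : ℤ, (f j).1.1 = matsFreq β n) : Real.pi / β ≤ |(∑ j, (f j).1).1| := by
  choose n hn using hf
  rw [Prod.fst_sum]
  have : ∑ j, (f j).1.1 = ∑ j, matsFreq β (n j) := Finset.sum_congr rfl fun j _ => hn j
  rw [this]
  exact pi_div_le_abs_sum_matsFreq hβ hk n

/-- Decoding `MIndex … = true`: `i ≥ 1`, `m₁, m₂ ≥ 1` and even, `m₁ + m₂ = m + 2i`.
[cite: Salmhofer1998, Proposition 2 (p.12 L95–98)] -/
theorem MIndex_true_iff (mbar : ℕ → ℕ) (r₁ r₂ m m₁ m₂ i : ℕ) :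
    MIndex mbar r₁ r₂ m m₁ m₂ i = true ↔
      1 ≤ i ∧ 1 ≤ m₁ ∧ m₁ ≤ mbar r₁ ∧ 1 ≤ m₂ ∧ m₂ ≤ mbar r₂ ∧ m₁ + m₂ = m + 2 * i ∧ m₁ % 2 = 0 ∧ m₂ % 2 = 0 := by
  simp [MIndex, Bool.and_eq_true, decide_eq_true_eq, and_assoc]

/-! ### Freezing beyond `log(βε₀/π)` at Matsubara external momenta -/

/-- **The right-hand side of the momentum-space RGE vanishes beyond `log(βε₀/π)` at Matsubara external momenta**
("`Q^N_{2,r} = 0` for `t > log βε₀`", p.25 L72; "`∂I^S_{4r}/∂t = 0` for `t > log βε₀`", p.25 L155; Lemma 3: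
"`∂I/∂t = 0` for all `t > log(β/2)`", p.18 L160–163): for ANY scale family whose `Ĉ_s` and `Ċ_s` vanish at all
frequencies `|x| ≥ π/β`, any selector and any vertex families, `Q_{m,r}(s | P) = 0` at Matsubara `P`.  Terms with
an integrated line contain a factor `Ĉ_s(ω_β(k₀), 𝐤) = 0`; the term without (`i = 1`) contains `Ċ_s(p₁+…+p_{m₁-1})`,
an odd number `m₁ - 1` of Matsubara legs (`m₁` even, Proposition 2).
[cite: Salmhofer1998, Theorem 4 proof (p.25 L71–74) and Theorem 5 proof (p.25 L153–155)] -/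
theorem momQuadTerm_eq_zero_of_freq (latt : ℝ) {β : ℝ} (hβ : 0 < β) (sel : ℕ → ℕ → ℕ → ℕ → Bool)
    {C Cdot : ℝ → FMom d → ℂ} {s : ℝ}
    (hC : ∀ (x : ℝ) (p : Mom d), Real.pi / β ≤ |x| → C s (x, p) = 0)
    (hCdot : ∀ (x : ℝ) (p : Mom d), Real.pi / β ≤ |x| → Cdot s (x, p) = 0)
    (I₁ I₂ : MomFamily d) (m r : ℕ) {P : Fin m → Leg d} (hP : IsMats β P) :
    momQuadTerm latt β sel C Cdot I₁ I₂ m r s P = 0 := by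
  classical
  unfold momQuadTerm kappaSum
  refine Finset.sum_eq_zero fun r₁ _ => Finset.sum_eq_zero fun m₁ _ => Finset.sum_eq_zero fun m₂ _ =>
    Finset.sum_eq_zero fun i _ => ?_
  beta_reduce
  split_ifs with hMI hcond hsel
  · rw [MIndex_true_iff] at hMI
    obtain ⟨hi1, hm1, -, -, -, -, hm1e, -⟩ := hMI
    -- the loop integral vanishes: its integrand is zero at every (Matsubara) loop configuration
    have hloop : ∀ (n : ℕ) (F : (Fin n → Leg d) → ℂ),
        (∀ (k : Fin n → FMom d) (sj : Fin n → Fin 2 × Fin 2), F (fun s' => (toMats β (k s'), sj s')) = 0) →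
        loopInt latt β n F = 0 := by
      intro n F hF
      unfold loopInt
      refine Finset.sum_eq_zero fun sj _ => ?_
      simp [hF]
    rw [hloop]
    · simp
    intro k sj
    beta_reduce
    rcases Nat.lt_or_ge 1 i with hi2 | hi1'
    · -- `i ≥ 2`: an integrated line `Ĉ_s(ω_β(k₀), 𝐤)` vanishes
      have h0 : 0 < i - 1 := by omega
      have hprod : (∏ s' : Fin (i - 1), legProp C s (toMats β (k s'), sj s')) = 0 := by
        refine Finset.prod_eq_zero (Finset.mem_univ ⟨0, h0⟩) (legProp_eq_zero_of_freq hC ?_)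
        exact pi_div_le_abs_omegaStep hβ _
      simp [hprod]
    · -- `i = 1`: the line `Ċ_s(p₁ + … + p_{m₁-1})`, an odd number of Matsubara legs
      obtain rfl : i = 1 := le_antisymm hi1' hi1
      have hodd : Odd (m₁ - 1) := Nat.odd_iff.mpr (by omega)
      refine Finset.sum_eq_zero fun sj₁ _ => ?_
      have hz : ∀ (A : FMom d), Real.pi / β ≤ |A.1| → legProp Cdot s (A, sj₁) = 0 := fun A hA =>
        legProp_eq_zero_of_freq hCdot hA
      rw [hz]
      · simp
      haveI : IsEmpty (Fin (1 - 1)) := ⟨fun x => absurd x.isLt (by omega)⟩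
      simp only [Finset.univ_eq_empty, Finset.sum_empty, neg_zero, zero_add]
      exact pi_div_le_abs_fst_sum_of_isMats hβ hodd _ fun μ => hP _
  · simp
  · simp
  · rfl


/-- For the many-fermion propagator: `Q_{m,r}(s | P) = 0` for `s > log(βε₀/π)` at Matsubara `P`, any selector
and any vertex families. [cite: Salmhofer1998, Theorem 4 proof (p.25 L71–74) and Lemma 4 (p.19 L133–135)] -/
theorem momQuadTerm_modelProp_eq_zero {M : ModelData d} (hM : M.Hyp) {χ₁ : ℝ → ℝ} (hχ : IsCutoff χ₁)
    {β : ℝ} (hβ : 0 < β) (sel : ℕ → ℕ → ℕ → ℕ → Bool) (I₁ I₂ : MomFamily d) (m r : ℕ) {s : ℝ}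
    (hs : Real.log (β * M.eps0 / Real.pi) < s) {P : Fin m → Leg d} (hP : IsMats β P) :
    momQuadTerm M.latt β sel (modelProp M χ₁) (modelPropDot M χ₁) I₁ I₂ m r s P = 0 :=
  momQuadTerm_eq_zero_of_freq M.latt hβ sel (fun _ p hx => modelProp_eq_zero_of_freq hM hχ hβ hs hx p)
    (fun _ p hx => modelPropDot_eq_zero_of_freq hM hχ hβ hs hx p) I₁ I₂ m r hP

/-- Matsubara-ness is a property of the frequencies only: permuting legs preserves it.
[cite: Salmhofer1998, §5.3 (p.18 L121–125)] -/
theorem IsMats.comp_perm {β : ℝ} {m : ℕ} {P : Fin m → Leg d} (hP : IsMats β P) (π : Equiv.Perm (Fin m)) :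
    IsMats β (P ∘ π) := fun μ => hP (π μ)

/-- Replacing the spatial momenta keeps the frequencies (hence Matsubara-ness).
[cite: Salmhofer1998, §6.3 (p.24 L84–93)] -/
theorem IsMats.withSpatial {β : ℝ} {m : ℕ} {P : Fin m → Leg d} (hP : IsMats β P) (q : Fin m → Mom d) :
    IsMats β (withSpatial P q) := fun μ => hP μ

/-- **Freezing of the flow beyond `T`**: if the right-hand side `Q_{m,r}(s | ·)` of the RGE vanishes at all
Matsubara configurations for `s > T ≥ 0`, then a solution of the integral equation is constant in `t ≥ T` at
Matsubara external momenta: `I_{m,r}(t | P) = I_{m,r}(T | P)` ("the integral for `I` over `t` runs only up to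
`log βε₀`", p.25 L72–74; no integrability is needed: the integrands agree on `[0, t]` off a set where both vanish).
[cite: Salmhofer1998, Theorem 4 proof (p.25 L71–74) and Remark 5 (p.17 L156–163)] -/
theorem momRGESolution_frozen {latt β : ℝ} {sel : ℕ → ℕ → ℕ → ℕ → Bool} {C Cdot : ℝ → FMom d → ℂ}
    {I : MomFamily d} (hsol : IsMomRGESolution latt β sel C Cdot I) {T : ℝ} (hT0 : 0 ≤ T)
    (hQ : ∀ s : ℝ, T < s → ∀ (m r : ℕ) (P : Fin m → Leg d), IsMats β P →
      momQuadTerm latt β sel C Cdot I I m r s P = 0)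
    {m r : ℕ} {t : ℝ} (ht : T ≤ t) {P : Fin m → Leg d} (hP : IsMats β P) : I m r t P = I m r T P := by
  have h1 := hsol m r t (hT0.trans ht) P
  have h2 := hsol m r T hT0 P
  rw [h1, h2]
  congr 2
  -- the antisymmetrised time integrals agree permutation by permutation
  simp only [antisym]
  congr 1
  refine Finset.sum_congr rfl fun π _ => ?_
  congr 1
  have hP' : IsMats β (P ∘ π) := hP.comp_perm π
  rw [intervalIntegral.integral_of_le (hT0.trans ht), intervalIntegral.integral_of_le hT0]
  calc ∫ s in Ioc 0 t, momQuadTerm latt β sel C Cdot I I m r s (P ∘ π)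
      = ∫ s in Ioc 0 t, (Iic T).indicator (fun s => momQuadTerm latt β sel C Cdot I I m r s (P ∘ π)) s := by
        refine setIntegral_congr_fun measurableSet_Ioc fun s hs => ?_
        by_cases hsT : s ≤ T
        · rw [indicator_of_mem (show s ∈ Iic T from hsT)]
        · rw [indicator_of_notMem (show s ∉ Iic T from hsT), hQ s (lt_of_not_ge hsT) m r _ hP']
    _ = ∫ s in Ioc 0 t ∩ Iic T, momQuadTerm latt β sel C Cdot I I m r s (P ∘ π) :=
        setIntegral_indicator measurableSet_Iic
    _ = ∫ s in Ioc 0 T, momQuadTerm latt β sel C Cdot I I m r s (P ∘ π) := by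
        have hset : Ioc 0 t ∩ Iic T = Ioc (0 : ℝ) T := by
          ext s
          simp only [mem_inter_iff, mem_Ioc, mem_Iic]
          constructor
          · rintro ⟨⟨h0, -⟩, hT⟩; exact ⟨h0, hT⟩
          · rintro ⟨h0, hT⟩; exact ⟨⟨h0, hT.trans ht⟩, hT⟩
        rw [hset]

/-- **Freezing for the many-fermion propagator**: every solution of the momentum-space RGE (any selector: full,
skeleton, non-ladder, ladder) with the propagator (5.17) is constant in `t` beyond `log(βε₀/π)` at Matsubara
external momenta. [cite: Salmhofer1998, Theorem 4 proof (p.25 L71–74) and Theorem 5 proof (p.25 L153–155)] -/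
theorem momRGESolution_modelProp_frozen {M : ModelData d} (hM : M.Hyp) {χ₁ : ℝ → ℝ} (hχ : IsCutoff χ₁)
    {β : ℝ} (hβ : 0 < β) {sel : ℕ → ℕ → ℕ → ℕ → Bool} {I : MomFamily d}
    (hsol : IsMomRGESolution M.latt β sel (modelProp M χ₁) (modelPropDot M χ₁) I) {T : ℝ} (hT0 : 0 ≤ T)
    (hT : Real.log (β * M.eps0 / Real.pi) < T) {m r : ℕ} {t : ℝ} (ht : T ≤ t) {P : Fin m → Leg d}
    (hP : IsMats β P) : I m r t P = I m r T P :=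
  momRGESolution_frozen hsol hT0
    (fun _ hs m r _ hP => momQuadTerm_modelProp_eq_zero hM hχ hβ sel I I m r (hT.trans hs) hP) ht hP

/-! ### The recursion (6.25) for the constants `K_{mr}` has a solution -/

/-- Fuelled evaluation of the recursion (6.25): `K_{m1} = K^{(0)}_{m1}`,
`K_{mr} = K^{(0)}_{mr} + (M₀/m) ∫dκ^S_{mr} i·i! (32J₁)^{i-1} K_{m₁r₁} K_{m₂r₂}` (`r ≥ 2`; the right side involves
only `r₁, r₂ < r`).  `skelKFuel n` is correct for all `r ≤ n` (`skelKFuel_stable`).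
[cite: Salmhofer1998, Theorem 6 (6.25) (p.24 L107–115)] -/
def skelKFuel (K0 : ℕ → ℕ → ℝ) (M₀ J₁ : ℝ) : ℕ → ℕ → ℕ → ℝ
  | 0, m, r => K0 m r
  | n + 1, m, r =>
    if r ≤ 1 then K0 m r
    else K0 m r + M₀ / m *
      Complex.re (kappaSum mfDeg m r fun r₁ m₁ r₂ m₂ i =>
        if 4 ≤ m₁ ∧ 4 ≤ m₂ then
          ((((i * i.factorial : ℕ) : ℝ) * (32 * J₁) ^ (i - 1) *
            skelKFuel K0 M₀ J₁ n m₁ r₁ * skelKFuel K0 M₀ J₁ n m₂ r₂ : ℝ) : ℂ)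
        else 0)

/-- **The constants `K_{mr}` of Theorems 6–7**, defined by the recursion (6.25) from `K^{(0)}`, `M₀`, `J₁`.
[cite: Salmhofer1998, Theorem 6 (6.25) (p.24 L107–115)] -/
def skelK (K0 : ℕ → ℕ → ℝ) (M₀ J₁ : ℝ) (m r : ℕ) : ℝ := skelKFuel K0 M₀ J₁ r m r

/-- `∫dκ_{mr}` only evaluates its argument at `(r₁, r - r₁)` with `1 ≤ r₁ ≤ r - 1`.
[cite: Salmhofer1998, Proposition 2 (p.12 L81–95)] -/
theorem kappaSum_congr (mbar : ℕ → ℕ) (m r : ℕ) {F G : ℕ → ℕ → ℕ → ℕ → ℕ → ℂ}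
    (h : ∀ r₁ m₁ m₂ i, 1 ≤ r₁ → r₁ ≤ r - 1 → F r₁ m₁ (r - r₁) m₂ i = G r₁ m₁ (r - r₁) m₂ i) :
    kappaSum mbar m r F = kappaSum mbar m r G := by
  unfold kappaSum
  refine Finset.sum_congr rfl fun r₁ hr₁ => Finset.sum_congr rfl fun m₁ _ => Finset.sum_congr rfl fun m₂ _ =>
    Finset.sum_congr rfl fun i _ => ?_
  rw [Finset.mem_Icc] at hr₁
  rw [h r₁ m₁ m₂ i hr₁.1 hr₁.2]

/-- Stabilisation of the fuelled recursion: for `r ≤ n`, `skelKFuel n m r = skelKFuel r m r`.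
[cite: Salmhofer1998, Theorem 6 (6.25) (p.24 L107–115)] -/
theorem skelKFuel_stable (K0 : ℕ → ℕ → ℝ) (M₀ J₁ : ℝ) :
    ∀ r n : ℕ, r ≤ n → ∀ m : ℕ, skelKFuel K0 M₀ J₁ n m r = skelKFuel K0 M₀ J₁ r m r := by
  intro r
  induction r using Nat.strong_induction_on with
  | _ r ih =>
    intro n hn m
    rcases Nat.lt_or_ge r 2 with hr | hr
    · -- `r ≤ 1`: every fuel level returns `K0 m r`
      have hval : ∀ k, skelKFuel K0 M₀ J₁ k m r = K0 m r := by
        intro k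
        cases k with
        | zero => rfl
        | succ k => simp [skelKFuel, show r ≤ 1 by omega]
      rw [hval, hval]
    · obtain ⟨n', rfl⟩ : ∃ n', n = n' + 1 := ⟨n - 1, by omega⟩
      obtain ⟨r', hr'⟩ : ∃ r', r = r' + 1 := ⟨r - 1, by omega⟩
      conv_rhs => rw [hr']
      simp only [skelKFuel, show ¬ r ≤ 1 by omega, show ¬ r' + 1 ≤ 1 by omega, if_false]
      rw [← hr']
      congr 2
      refine congrArg _ (kappaSum_congr mfDeg m r fun r₁ m₁ m₂ i h1 h2 => ?_)
      have e1 : skelKFuel K0 M₀ J₁ n' m₁ r₁ = skelKFuel K0 M₀ J₁ r' m₁ r₁ := by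
        rw [ih r₁ (by omega) n' (by omega) m₁, ih r₁ (by omega) r' (by omega) m₁]
      have e2 : skelKFuel K0 M₀ J₁ n' m₂ (r - r₁) = skelKFuel K0 M₀ J₁ r' m₂ (r - r₁) := by
        rw [ih (r - r₁) (by omega) n' (by omega) m₂, ih (r - r₁) (by omega) r' (by omega) m₂]
      rw [e1, e2]

/-- **`skelK` satisfies the recursion (6.25)** (`IsSkeletonK K0 M₀ J₁ (skelK K0 M₀ J₁)`): the constants of
Theorems 6–7 exist for every `K^{(0)}`, `M₀`, `J₁`. [cite: Salmhofer1998, Theorem 6 (6.25) (p.24 L107–115)] -/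
theorem isSkeletonK_skelK (K0 : ℕ → ℕ → ℝ) (M₀ J₁ : ℝ) : IsSkeletonK K0 M₀ J₁ (skelK K0 M₀ J₁) := by
  refine ⟨fun m => by simp [skelK, skelKFuel], fun m r hr => ?_⟩
  obtain ⟨r', hr'⟩ : ∃ r', r = r' + 1 := ⟨r - 1, by omega⟩
  unfold skelK
  conv_lhs => rw [hr']
  simp only [skelKFuel, show ¬ r' + 1 ≤ 1 by omega, if_false]
  rw [← hr']
  congr 2
  refine congrArg _ (kappaSum_congr mfDeg m r fun r₁ m₁ m₂ i h1 h2 => ?_)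
  rw [skelKFuel_stable K0 M₀ J₁ r₁ r' (by omega) m₁, skelKFuel_stable K0 M₀ J₁ (r - r₁) r' (by omega) m₂]


/-! ### Locality of the spatial derivatives on the Matsubara set -/

/-- A coordinate partial `∂/∂(𝐩_μ)_ν` at a Matsubara configuration only sees the function on Matsubara
configurations (the spatial section keeps the frequencies). [cite: Salmhofer1998, §6.3 (p.24 L84–93)] -/
theorem legPartial_congr_mats {β : ℝ} {m : ℕ} {F G : (Fin m → Leg d) → ℂ}
    (h : ∀ P : Fin m → Leg d, IsMats β P → F P = G P) (μ : Fin m) (ν : Fin d)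
    (P : Fin m → Leg d) (hP : IsMats β P) : legPartial μ ν F P = legPartial μ ν G P := by
  unfold legPartial
  rw [show (fun q : Fin m → Mom d => F (withSpatial P q)) = fun q => G (withSpatial P q) from
    funext fun q => h _ (hP.withSpatial q)]

/-- Iterated coordinate partials of two functions agreeing on the Matsubara set agree there.
[cite: Salmhofer1998, §6.3 (p.24 L84–93)] -/
theorem iterLegPartial_congr_mats {β : ℝ} {m : ℕ} {F G : (Fin m → Leg d) → ℂ}
    (h : ∀ P : Fin m → Leg d, IsMats β P → F P = G P) (l : List (Fin m × Fin d)) :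
    ∀ P : Fin m → Leg d, IsMats β P → iterLegPartial l F P = iterLegPartial l G P := by
  induction l with
  | nil => exact h
  | cons a l ih =>
    intro P hP
    change legPartial a.1 a.2 (iterLegPartial l F) P = legPartial a.1 a.2 (iterLegPartial l G) P
    exact legPartial_congr_mats ih a.1 a.2 P hP

/-- `D^α F(P) = D^α G(P)` at Matsubara `P` when `F = G` on the Matsubara set.
[cite: Salmhofer1998, §6.3 (p.24 L84–93)] -/
theorem multiLegPartial_congr_mats {β : ℝ} {m : ℕ} {F G : (Fin m → Leg d) → ℂ}
    (h : ∀ P : Fin m → Leg d, IsMats β P → F P = G P) (α : Fin m → Fin d → ℕ)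
    (P : Fin m → Leg d) (hP : IsMats β P) : multiLegPartial α F P = multiLegPartial α G P := by
  unfold multiLegPartial
  exact iterLegPartial_congr_mats h _ P hP

/-- `D^0 F = F`. [cite: Salmhofer1998, Theorem 6 (p.24 L99–104)] -/
theorem multiLegPartial_zero {m : ℕ} (F : (Fin m → Leg d) → ℂ) :
    multiLegPartial (0 : Fin m → Fin d → ℕ) F = F := by
  have h : ((List.finRange m).flatMap fun μ => (List.finRange d).flatMap fun ν =>
      List.replicate ((0 : Fin m → Fin d → ℕ) μ ν) (μ, ν)) = [] := by
    simp [List.flatMap_eq_nil_iff]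
  rw [multiLegPartial, h]
  rfl

/-- `|0| = 0`. [cite: Salmhofer1998, Theorem 6 (p.24 L99–100)] -/
theorem lmiDeg_zero {m : ℕ} : lmiDeg (0 : Fin m → Fin d → ℕ) = 0 := by
  simp [lmiDeg]

/-- `δ_{d,2} ≤ 1`. [cite: Salmhofer1998, Theorem 6 (6.26) (p.24 L118–123)] -/
theorem deltaTwo_le_one (d : ℕ) : deltaTwo d ≤ 1 := by
  unfold deltaTwo
  split_ifs <;> simp

/-! ### Elementary numerics of the window `βε₀ ≥ 6` and the freezing time `T = log(βε₀) - 1` -/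

/-- `log x > 1` for `x ≥ 6`. [folklore] [cite: Salmhofer1998, §2 (p.7 L12–14)] -/
theorem one_lt_log_of_six_le {x : ℝ} (hx : 6 ≤ x) : 1 < Real.log x := by
  rw [Real.lt_log_iff_exp_lt (by linarith)]
  linarith [Real.exp_one_lt_d9]

/-- The freezing time `T = log(βε₀) - 1` is nonnegative and exceeds Lemma 4's threshold `log(βε₀/π)` (as
`log π > 1`), for `βε₀ ≥ 6`. [cite: Salmhofer1998, Theorem 4 proof (p.25 L71–74) and Lemma 4 (p.19 L133–135)] -/
theorem freeze_window {x : ℝ} (hx : 6 ≤ x) :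
    0 ≤ Real.log x - 1 ∧ Real.log (x / Real.pi) < Real.log x - 1 := by
  have h1 := one_lt_log_of_six_le hx
  -- `log π > 1` (`π > e`); a standalone copy is `Literature.NumberTheory.LFunctions.NumberField.one_lt_log_pi`
  -- (not imported: it would pull the L-function cone into this file).
  have hπ : 1 < Real.log Real.pi := by
    rw [Real.lt_log_iff_exp_lt Real.pi_pos]
    linarith [Real.exp_one_lt_d9, Real.pi_gt_three]
  refine ⟨by linarith, ?_⟩
  rw [Real.log_div (by linarith) Real.pi_pos.ne']
  linarith

/-- `ε_t⁻¹ = e^t/ε₀ ≤ β` for `t ≤ log(βε₀)` ("`t = log βε₀`", p.25 L74).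
[cite: Salmhofer1998, Theorem 4 proof (p.25 L71–75)] -/
theorem inv_epsT_le_beta {eps0 β t : ℝ} (h0 : 0 < eps0) (hβε : 0 < β * eps0)
    (ht : t ≤ Real.log (β * eps0)) : (epsT eps0 t)⁻¹ ≤ β := by
  unfold epsT
  rw [mul_inv, Real.exp_neg, inv_inv]
  calc eps0⁻¹ * Real.exp t ≤ eps0⁻¹ * Real.exp (Real.log (β * eps0)) := by gcongr
    _ = β := by rw [Real.exp_log hβε]; field_simp

/-- If `‖x‖ ≤ K·c` with `c > 0` then `K ≥ 0`. [folklore] [cite: Salmhofer1998, Theorem 6 (p.24 L99–104)] -/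
theorem nonneg_of_norm_le_mul {x : ℂ} {K c : ℝ} (hc : 0 < c) (h : ‖x‖ ≤ K * c) : 0 ≤ K := by
  by_contra hK
  have : K * c < 0 := mul_neg_of_neg_of_pos (lt_of_not_ge hK) hc
  linarith [norm_nonneg x]

/-- An eventually constant function of `t` converges. [cite: Salmhofer1998, Theorem 4 proof (p.25 L71–74)] -/
theorem tendsto_of_frozen {m : ℕ} {I : MomFamily d} {r : ℕ} {T β : ℝ}
    (hfrz : ∀ t : ℝ, T ≤ t → ∀ P : Fin m → Leg d, IsMats β P → I m r t P = I m r T P)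
    (P : Fin m → Leg d) (hP : IsMats β P) :
    Tendsto (fun t : ℝ => I m r t P) atTop (𝓝 (I m r T P)) := by
  have hev : (fun _ : ℝ => I m r T P) =ᶠ[atTop] fun t => I m r t P :=
    Filter.eventuallyEq_of_mem (Filter.Ici_mem_atTop T) fun t ht => (hfrz t ht P hP).symm
  exact Tendsto.congr' hev tendsto_const_nhds

/-- `K_{21} = K^{(0)}_{21} = 0` (the order-one two-point datum vanishes: `K^{(0)}_{m1} = δ_{m4} v`).
[cite: Salmhofer1998, Theorem 6 (p.24 L101–104)] -/
theorem skeletonK_two_one {I : MomFamily d} {K0 K : ℕ → ℕ → ℝ} {v M₀ J₁ : ℝ}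
    (hinit : InitialDataBounds I K0 v) (hK : IsSkeletonK K0 M₀ J₁ K) : K 2 1 = 0 := by
  rw [hK.1 2, hinit.2.2.2.2.2.2 2]
  simp

/-! ### Theorem 5 from Theorem 7 (print's proof of Theorem 5, p.25 L150–156) -/

/-- **Theorem 5 follows from Theorem 7** ("Convergence follows from the bounds (6.34) and (6.36) by
standard arguments. (6.22) is a direct consequence of (6.34) and (6.36)", p.25 L150–156): with
`K^{(5)}_{mr} := K_{mr}` from (6.25) (constructed: `skelK`), (6.36) gives the `m = 2` clause of (6.22) since
`L^{r-2}, L^{r-2}L^{1+δ_{d,2}} ≤ L^r` for `L = log βε₀ ≥ 1` (`r = 1`: `K_{21} = 0`), (6.34) at `m = 4`, `α = 0`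
gives the four-point clause, and convergence holds because the flow is frozen beyond `log(βε₀/π)` at Matsubara
frequencies (Lemma 4).  A sorry-free reduction of the named fact `SkeletonWithLadderBounds` (F-095) to
`SkeletonLogBounds` (F-097). [cite: Salmhofer1998, Theorem 5 proof (p.25 L150–156)] -/
theorem skeletonWithLadderBounds_of_skeletonLogBounds (h7 : SkeletonLogBounds) :
    SkeletonWithLadderBounds := by
  intro d M χ₁ B K₀ J₁ v K0 hd hM hk0 hχ hB hK₀ hJ₁
  obtain ⟨M₀, -, h7⟩ := h7 d M χ₁ B K₀ hd hM hk0 hχ hB hK₀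
  refine ⟨skelK K0 M₀ J₁, fun β hβ hβε hloop I hsol hinit r hr => ?_⟩
  have hK := isSkeletonK_skelK K0 M₀ J₁
  have h7' := h7 J₁ β hJ₁ hβ hβε hloop I K0 (skelK K0 M₀ J₁) v hsol hinit hK
  obtain ⟨hT0, hT⟩ := freeze_window hβε
  have hfrz : ∀ (m r : ℕ) (t : ℝ), Real.log (β * M.eps0) - 1 ≤ t → ∀ P : Fin m → Leg d, IsMats β P →
      I m r t P = I m r (Real.log (β * M.eps0) - 1) P :=
    fun m r t ht P hP => momRGESolution_modelProp_frozen hM hχ hβ hsol hT0 hT ht hP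
  have hL1 : 1 ≤ Real.log (β * M.eps0) := (one_lt_log_of_six_le hβε).le
  have hL0 : 0 < Real.log (β * M.eps0) := one_pos.trans_le hL1
  refine ⟨fun P hP => ⟨_, tendsto_of_frozen (hfrz 2 r) P hP⟩,
    fun P hP => ⟨_, tendsto_of_frozen (hfrz 4 r) P hP⟩, fun t ht => ⟨?_, ?_⟩⟩
  · intro α hα P hP
    obtain ⟨-, -, -, -, h36a, h36b⟩ := h7' t ht 2 r hr α hα P hP
    rcases Nat.lt_or_ge (lmiDeg α) 2 with h1 | h2
    · have hb := h36a rfl (by omega)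
      have hKnn : 0 ≤ skelK K0 M₀ J₁ 2 r := nonneg_of_norm_le_mul (pow_pos hL0 _) hb
      exact hb.trans (mul_le_mul_of_nonneg_left (pow_le_pow_right₀ hL1 (by omega)) hKnn)
    · have hb := h36b rfl (le_antisymm hα h2)
      rcases Nat.lt_or_ge r 2 with hr1 | hr2
      · obtain rfl : r = 1 := by omega
        rw [skeletonK_two_one hinit hK] at hb ⊢
        simpa using hb
      · rw [mul_assoc, ← pow_add] at hb
        have hKnn : 0 ≤ skelK K0 M₀ J₁ 2 r := nonneg_of_norm_le_mul (pow_pos hL0 _) hb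
        refine hb.trans (mul_le_mul_of_nonneg_left (pow_le_pow_right₀ hL1 ?_) hKnn)
        have := deltaTwo_le_one d
        omega
  · intro P hP
    obtain ⟨-, -, h34, -, -, -⟩ := h7' t ht 4 r hr 0 (by simp [lmiDeg]) P hP
    have hb := h34 le_rfl (by norm_num)
    rw [multiLegPartial_zero, lmiDeg_zero] at hb
    norm_num at hb
    have hKnn : 0 ≤ skelK K0 M₀ J₁ 4 r := nonneg_of_norm_le_mul (pow_pos hL0 _) hb
    exact hb.trans (mul_le_mul_of_nonneg_left (pow_le_pow_right₀ hL1 (by omega)) hKnn)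

/-! ### Theorem 4 from Theorem 6 (print's proof of Theorem 4, p.25 L64–75) -/

/-- **Theorem 4 follows from Theorem 6** ("Theorem 4 follows from Theorem 6 by Lemma 4: if `t > log(βε₀/π)`,
`Ĉ_t = 0 = Ċ_t` on Matsubara frequencies, so the integral for `I` over `t` runs only up to `log βε₀`, and
(6.20), (6.21) follow from (6.28), (6.29) with `t = log βε₀`", p.25 L71–75): with `K` from (6.25) (`skelK`),
freezing time `T = log(βε₀) - 1` (`> log(βε₀/π)` as `log π > 1`; `1 + T = log βε₀`, `ε_T⁻¹ ≤ β`),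
`K^{(2)}_r := K_{2r}`, `K^{(4)}_r := K_{4r}(1 + ε₀⁻¹)`, and the limit `S := I_{2,r}(T | ·)`, `C²` by Theorem 6.
A sorry-free reduction of the named fact `SkeletonSelfEnergyRegularity` (F-094) to `SkeletonRegularity` (F-096).
[cite: Salmhofer1998, Theorem 4 proof (p.25 L64–75)] -/
theorem skeletonSelfEnergyRegularity_of_skeletonRegularity (h6 : SkeletonRegularity) :
    SkeletonSelfEnergyRegularity := by
  intro d M χ₁ B K₀ J₁ v K0 hd hM hk0 hχ hB hK₀ hJ₁
  obtain ⟨M₀, -, h6⟩ := h6 d M χ₁ B K₀ hd hM hk0 hχ hB hK₀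
  refine ⟨skelK K0 M₀ J₁ 2, fun r => skelK K0 M₀ J₁ 4 r * (1 + M.eps0⁻¹),
    fun β hβ hβε hloop I hsol hinit r hr => ?_⟩
  have hK := isSkeletonK_skelK K0 M₀ J₁
  obtain ⟨-, hC2, h6'⟩ := h6 J₁ β hJ₁ hβ hloop I K0 (skelK K0 M₀ J₁) v hsol hinit hK
  obtain ⟨hT0, hT⟩ := freeze_window hβε
  have hfrz : ∀ (m r : ℕ) (t : ℝ), Real.log (β * M.eps0) - 1 ≤ t → ∀ P : Fin m → Leg d, IsMats β P →
      I m r t P = I m r (Real.log (β * M.eps0) - 1) P :=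
    fun m r t ht P hP => momRGESolution_modelProp_frozen hM hχ hβ hsol hT0 hT ht hP
  have hL1 : 1 ≤ Real.log (β * M.eps0) := (one_lt_log_of_six_le hβε).le
  have hL0 : 0 < Real.log (β * M.eps0) := one_pos.trans_le hL1
  have hε0 := hM.eps0_pos
  have hβε0 : 0 < β * M.eps0 := mul_pos hβ hε0
  -- evaluation time `t' = min t T`: the derivative at `t` equals the derivative at `t'`, `0 ≤ t' ≤ T`
  have heval : ∀ (m r : ℕ) (t : ℝ), 0 ≤ t → ∀ (α : Fin m → Fin d → ℕ) (P : Fin m → Leg d), IsMats β P →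
      ∃ t' : ℝ, 0 ≤ t' ∧ t' ≤ Real.log (β * M.eps0) - 1 ∧
        multiLegPartial α (I m r t) P = multiLegPartial α (I m r t') P := by
    intro m r t ht α P hP
    rcases le_total t (Real.log (β * M.eps0) - 1) with h | h
    · exact ⟨t, ht, h, rfl⟩
    · exact ⟨_, hT0, le_rfl, multiLegPartial_congr_mats (fun P hP => hfrz m r t h P hP) α P hP⟩
  refine ⟨⟨fun P => I 2 r (Real.log (β * M.eps0) - 1) P, fun P hP => tendsto_of_frozen (hfrz 2 r) P hP,
    fun P _ => hC2 2 r _ hr hT0 P⟩, fun t ht α hα P hP => ?_, fun t ht α hα P hP => ?_⟩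
  · -- (6.20) from (6.29)
    obtain ⟨t', ht'0, ht'T, hD⟩ := heval 2 r t ht α P hP
    rw [hD]
    obtain ⟨-, -, -, -, -, -, -, h29a, h29b, h29c⟩ := h6' t' ht'0 2 r hr α hα P
    have h1t' : 1 + t' ≤ Real.log (β * M.eps0) := by linarith
    have h1t'0 : 0 < 1 + t' := by linarith
    refine ⟨fun h1 => h29a rfl h1, fun h2 hd2 => ?_, fun h2 hd3 => ?_⟩
    · have hb := h29b rfl h2 hd2
      have hKnn : 0 ≤ skelK K0 M₀ J₁ 2 r := nonneg_of_norm_le_mul (pow_pos h1t'0 2) hb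
      exact hb.trans (mul_le_mul_of_nonneg_left (pow_le_pow_left₀ h1t'0.le h1t' 2) hKnn)
    · have hb := h29c rfl h2 hd3
      have hKnn : 0 ≤ skelK K0 M₀ J₁ 2 r := nonneg_of_norm_le_mul h1t'0 hb
      exact hb.trans (mul_le_mul_of_nonneg_left h1t' hKnn)
  · -- (6.21) from (6.28)
    beta_reduce
    obtain ⟨t', ht'0, ht'T, hD⟩ := heval 4 r t ht α P hP
    rw [hD]
    obtain ⟨-, -, -, -, h28a, h28b, h28c, -, -, -⟩ := h6' t' ht'0 4 r hr α hα P
    obtain ⟨-, -, -, -, h0, -, -, -, -, -⟩ := h6' t' ht'0 4 r hr 0 (by simp [lmiDeg]) P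
    have hKnn : 0 ≤ skelK K0 M₀ J₁ 4 r := (norm_nonneg _).trans (h0 rfl lmiDeg_zero)
    have h1t' : 1 + t' ≤ Real.log (β * M.eps0) := by linarith
    have h1t'0 : 0 < 1 + t' := by linarith
    have hc1 : 1 ≤ 1 + M.eps0⁻¹ := le_add_of_nonneg_right (inv_nonneg.mpr hε0.le)
    have hK4 : skelK K0 M₀ J₁ 4 r ≤ skelK K0 M₀ J₁ 4 r * (1 + M.eps0⁻¹) := le_mul_of_one_le_right hKnn hc1
    have hK40 : 0 ≤ skelK K0 M₀ J₁ 4 r * (1 + M.eps0⁻¹) := hKnn.trans hK4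
    refine ⟨fun h0' => (h28a rfl h0').trans hK4, fun h1 => ?_, fun h2 => ?_⟩
    · have hb := h28b rfl h1
      refine hb.trans (mul_le_mul hK4 ?_ (pow_nonneg h1t'0.le 2) hK40)
      exact pow_le_pow_left₀ h1t'0.le (by linarith) 2
    · have hb := h28c rfl h2
      have hεinv : (epsT M.eps0 t')⁻¹ ≤ β := inv_epsT_le_beta hε0 hβε0 (by linarith)
      have hβ' : β ≤ (1 + M.eps0⁻¹) * (β * M.eps0) := by
        have h := hε0.ne'
        calc β = M.eps0⁻¹ * (β * M.eps0) := by field_simp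
          _ ≤ (1 + M.eps0⁻¹) * (β * M.eps0) :=
            mul_le_mul_of_nonneg_right (by linarith [inv_nonneg.mpr hε0.le]) hβε0.le
      have hY0 : 0 ≤ (1 + M.eps0⁻¹) * (β * M.eps0) := hβ.le.trans hβ'
      calc ‖multiLegPartial α (I 4 r t') P‖
          ≤ skelK K0 M₀ J₁ 4 r * (epsT M.eps0 t')⁻¹ * (1 + t') := hb
        _ = skelK K0 M₀ J₁ 4 r * ((epsT M.eps0 t')⁻¹ * (1 + t')) := by ring
        _ ≤ skelK K0 M₀ J₁ 4 r * (β * Real.log (β * M.eps0)) :=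
          mul_le_mul_of_nonneg_left (mul_le_mul hεinv h1t' h1t'0.le hβ.le) hKnn
        _ ≤ skelK K0 M₀ J₁ 4 r * ((1 + M.eps0⁻¹) * (β * M.eps0) * (1 + Real.log (β * M.eps0))) :=
          mul_le_mul_of_nonneg_left (mul_le_mul hβ' (by linarith) hL0.le hY0) hKnn
        _ = skelK K0 M₀ J₁ 4 r * (1 + M.eps0⁻¹) * (β * M.eps0) * (1 + Real.log (β * M.eps0)) := by
          ring

/-! ### Theorem 6, first conclusion: `K_{mr} = 0` for `m > 2r + 2` -/

/-- `∫dκ_{mr}` with the degree bound `m̄(r) = 2r+2` is the empty sum when `m > 2r+2`: every index of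
`𝓜_{r₁r₂m}` has `m = m₁ + m₂ - 2i ≤ m̄(r₁) + m̄(r₂) - 2 = 2r + 2` (Lemma 3, p.18 L138–145: "`I_{mr}(t) = 0` if
`m > 2r+2`"). [cite: Salmhofer1998, Lemma 3 (p.18 L138–145) and Proposition 2 (p.12 L81–98)] -/
theorem kappaSum_mfDeg_eq_zero {m r : ℕ} (hm : 2 * r + 2 < m) (F : ℕ → ℕ → ℕ → ℕ → ℕ → ℂ) :
    kappaSum mfDeg m r F = 0 := by
  unfold kappaSum
  refine Finset.sum_eq_zero fun r₁ hr₁ => Finset.sum_eq_zero fun m₁ _ => Finset.sum_eq_zero fun m₂ _ =>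
    Finset.sum_eq_zero fun i _ => ?_
  rw [Finset.mem_Icc] at hr₁
  split_ifs with h
  · rw [MIndex_true_iff] at h
    obtain ⟨hi, -, hm1, -, hm2, hsum, -, -⟩ := h
    unfold mfDeg at hm1 hm2
    omega
  · rfl

/-- **Theorem 6, first conclusion ("Then `K_{mr} = 0` for `m > 2r+2`", p.24 L115–116)**, for EVERY `K`
satisfying the recursion (6.25) from initial constants with `K^{(0)}_{mr} = 0` for `m > 2r+2` and
`K^{(0)}_{m1} = δ_{m4} v` (`InitialDataBounds`): for `r ≥ 2` the skeleton `∫dκ^S_{mr}` in (6.25) is empty when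
`m > 2r+2` (`kappaSum_mfDeg_eq_zero`), so `K_{mr} = K^{(0)}_{mr} = 0`; for `r = 1`, `K_{m1} = δ_{m4} v = 0` as
`m > 4`.  This is the clause `∀ m r, 1 ≤ r → 2r+2 < m → K m r = 0` of `SkeletonRegularity`, proved outright.
[cite: Salmhofer1998, Theorem 6 (p.24 L99–116) and Lemma 3 (p.18 L138–145)] -/
theorem skeletonK_eq_zero_of_deg {I : MomFamily d} {K0 K : ℕ → ℕ → ℝ} {v M₀ J₁ : ℝ}
    (hinit : InitialDataBounds I K0 v) (hK : IsSkeletonK K0 M₀ J₁ K) {m r : ℕ} (hr : 1 ≤ r)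
    (hm : 2 * r + 2 < m) : K m r = 0 := by
  rcases Nat.lt_or_ge r 2 with h1 | h2
  · obtain rfl : r = 1 := by omega
    rw [hK.1 m, hinit.2.2.2.2.2.2 m, if_neg (by omega)]
  · rw [hK.2 m r h2, kappaSum_mfDeg_eq_zero hm, hinit.2.2.2.2.1 m r hm]
    simp

end Salmhofer1998

end Literature.MathematicalPhysics.QuantumLattice.FermiRG
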